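import Literature.NumberTheory.Sieve.MaynardTao
import Literature.NumberTheory.Sieve.PolymathBoundedGaps
import Literature.NumberTheory.Sieve.LevelOfDistribution
import Literature.NumberTheory.Sieve.PolymathProductTestFunctions
import Literature.NumberTheory.Sieve.ParityBarrierLevelProofs
import Literature.NumberTheory.Sieve.MaynardTaoTheoremProofs
import Literature.NumberTheory.Sieve.NarrowAdmissibleTuple3750
import Summits.Parity.GeneralizedHardyLittlewood.Theses.MaynardProductExact

/-! # MaynardProductExact — the PROVED support items of `route-Parity-MaynardProductExact` (rev 5)
`certGlue_holds : CertGlue` (stmt-Parity-19286: the two certificate halves NumLB3749, DenUB3750 give M_3750 > 8 over the tree identity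
`maynardFunctional_productTestFn_polymathProfile`; key arithmetic 8·0.41694·m₂ < 3750·1.9076·10⁻⁶), `assembly_holds : Assembly` (stmt-Parity-19288:
MkCert3750 → Tuple3750 → HTwoLe34052 from Bombieri–Vinogradov at level ϑ = 1/4 + 2/M, Maynard Prop. 4.2 via PM8b Thm 3.8, and the tuple step), and
`tuple3750_holds : Tuple3750` (stmt-Parity-19287: the admissible 3750-tuple of diameter 34052, by the kernel-decided Literature theorem
`exists_isAdmissibleTuple_card_3750` of `NarrowAdmissibleTuple3750.lean`), proved against the
ROUTE FILE's own declarations; plus the rung reduction `hTwoLe34052_of : NumLB3749 → DenUB3750 → Tuple3750 → HTwoLe34052`.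
Drafted by parity-ideate-p3 g4 (route4/TheoremsDraft_MaynardProductExactGlue.lean, farm-checked); `tuple3750_holds` upgrade per the
referee g18 verdict (probe farm rc 0, axioms std). Closes items 19286, 19288 and 19287; open cone of
`route-Parity-MaynardProductExact` = {NumLB3749, DenUB3750} exactly (the two kernel certificates). -/

noncomputable section

namespace Summit.Parity.GeneralizedHardyLittlewood.Theses.MaynardProductExact

open _root_.Filter _root_.MeasureTheory _root_.Set intervalIntegral
open Literature.NumberTheory.Sieve Literature.NumberTheory.Sieve.MaynardTao Literature.Analysis.Convolution

/-- arithmetic core of the certificate glue, with the base `x = m₂` abstracted (so that `ring` treats `x ^ 3749` as an atom). -/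
theorem core_ineq {x N D : ℝ} (hx : 0 < x) (hD : 0 < D)
    (h₁ : (19076 : ℝ) / 10000000000 * x ^ 3749 ≤ N) (h₂ : D ≤ (41694 : ℝ) / 100000 * x ^ 3750)
    (hkey : (8 : ℝ) * ((41694 : ℝ) / 100000 * x) < 3750 * ((19076 : ℝ) / 10000000000)) :
    (8 : ℝ) < 3750 * N / D := by
  have hpow : (0 : ℝ) < x ^ 3749 := pow_pos hx _
  rw [lt_div_iff₀ hD]
  calc (8 : ℝ) * D ≤ (8 : ℝ) * ((41694 : ℝ) / 100000 * x ^ 3750) :=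
        mul_le_mul_of_nonneg_left h₂ (by norm_num)
    _ = ((8 : ℝ) * ((41694 : ℝ) / 100000 * x)) * x ^ 3749 := by ring
    _ < (3750 * ((19076 : ℝ) / 10000000000)) * x ^ 3749 := mul_lt_mul_of_pos_right hkey hpow
    _ = (3750 : ℝ) * ((19076 : ℝ) / 10000000000 * x ^ 3749) := by ring
    _ ≤ (3750 : ℝ) * N := mul_le_mul_of_nonneg_left h₁ (by norm_num)

namespace Cert

/-- the certificate's profile `g = 1/(c+(k−1)t)·1_{[0,T]}`, `(k,c,T) = (3750, 249/2000, 3/4)`. -/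
def g : ℝ → ℝ := polymathProfile 3750 ((249 : ℝ) / 2000) ((3 : ℝ) / 4)
/-- numerator `N`. -/
def Num : ℝ := ∫ w in Ioc (0:ℝ) 1, (∫ u in (0:ℝ)..(1 - w), g u) ^ 2 * cpow (fun t => g t ^ 2) 3749 w
/-- denominator `D`. -/
def Den : ℝ := ∫ w in Ioc (0:ℝ) 1, cpow (fun t => g t ^ 2) 3750 w

/-- `MkCert3750` from the two numerical certificate halves: the numerator lower bound and the
denominator upper bound (stated with the base `m₂ = 1000000/466771167` explicit) give
`maynardFunctional 3750 (productTestFn 3750 g) = 3750·Num/Den > 8` by `core_ineq`. -/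
theorem mkCert_of_bounds
    (h₁ : (19076 : ℝ) / 10000000000 * ((1000000 : ℝ) / 466771167) ^ 3749 ≤ Num)
    (h₂ : Den ≤ (41694 : ℝ) / 100000 * ((1000000 : ℝ) / 466771167) ^ 3750) : MkCert3750 := by
  have hc : (0 : ℝ) < (249 : ℝ) / 2000 := by norm_num
  have hT : (0 : ℝ) < (3 : ℝ) / 4 := by norm_num
  have hadm : IsMaynardAdmissible 3750 (productTestFn 3750 g) :=
    isMaynardAdmissible_productTestFn_polymathProfile (k := 3750) (by norm_num) hc hT
  refine ⟨productTestFn 3750 g, hadm, ?_⟩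
  have hid : maynardFunctional 3750 (productTestFn 3750 g) = (3750 : ℝ) * Num / Den := by
    have h := maynardFunctional_productTestFn_polymathProfile 3748 hc hT
    norm_num at h
    simpa [g, Num, Den] using h
  have hDen : 0 < Den := by
    have hg : LocBdd g := locBdd_polymathProfile (k := 3750) (by norm_num) hc hT.le
    have hI := hadm.maynardI_pos
    rw [maynardI_productTestFn_eq_cpow (k := 3750) (g := g) (by norm_num) hg] at hI
    simpa [Den] using hI
  rw [hid]
  have hx : (0 : ℝ) < (1000000 : ℝ) / 466771167 := by norm_num
  have hk : (8 : ℝ) * ((41694 : ℝ) / 100000 * ((1000000 : ℝ) / 466771167)) < 3750 * ((19076 : ℝ) / 10000000000) := by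
    norm_num
  exact core_ineq hx hDen h₁ h₂ hk

end Cert

/-- PROVED: the certificate glue `NumLB3749 → DenUB3750 → MkCert3750`. -/
theorem certGlue_holds : CertGlue := fun h₁ h₂ =>
  Cert.mkCert_of_bounds (by simpa [NumLB3749, Cert.Num, Cert.g] using h₁) (by simpa [DenUB3750, Cert.Den, Cert.g] using h₂)

/-- PROVED: the assembly, from the tree theorems Bombieri–Vinogradov (at ϑ = 1/4 + 2/M ∈ (4/M, 1/2)), Maynard Prop. 4.2 via PM8b Thm 3.8, and the tuple step. -/
theorem assembly_holds : Assembly := by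
  intro h₁ h₂
  obtain ⟨F, hF, hM⟩ := h₁
  obtain ⟨H, hH, hcard, hdiam⟩ := h₂
  -- level ϑ := 1/4 + 2/M ∈ (4/M, 1/2) since M > 8
  set M : ℝ := maynardFunctional 3750 F with hMdef
  have hMpos : 0 < M := lt_trans (by norm_num) hM
  have hϑlt : (1 : ℝ) / 4 + 2 / M < 1 / 2 := by
    have h2M : 2 / M < 1 / 4 := by
      rw [div_lt_iff₀ hMpos]; linarith
    linarith
  have hϑpos : (0 : ℝ) < 1 / 4 + 2 / M := by positivity
  have hθ : PrimesHaveLevel ((1 : ℝ) / 4 + 2 / M) := BombieriVinogradovStatement_holds _ hϑlt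
  have hcrit : (2 : ℝ) * ((2 : ℕ) : ℝ) / (1 / 4 + 2 / M) < maynardFunctional 3750 F := by
    rw [← hMdef, div_lt_iff₀ hϑpos]
    have hexp : M * (1 / 4 + 2 / M) = M / 4 + 2 := by
      field_simp
    rw [hexp]; push_cast; linarith
  have hDHL : WeakDicksonHardyLittlewood 3750 (2 + 1) :=
    weakDHL_of_maynardFunctional_gt frequently_card_primes_ge_of_maynardFunctional_holds hϑpos hθ hF hcrit
  exact hDHL.frequently_nth_prime_add_le hH hcard (d := 34052) (by exact_mod_cast hdiam)

/-- PROVED: the tuple support `Tuple3750` (stmt-Parity-19287), by the kernel-decided Literature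
theorem for Sutherland's admissible 3750-tuple of diameter 34052.
[cite: SutherlandNarrowAdmissibleTuples, file admissible_3750_34052.txt] -/
theorem tuple3750_holds : Summit.Parity.GeneralizedHardyLittlewood.Theses.MaynardProductExact.Tuple3750 :=
  Literature.NumberTheory.Sieve.exists_isAdmissibleTuple_card_3750

/-- the rung from the two certificate cruxes and the tuple alone (route `closes` with the two proved supports discharged). -/
theorem hTwoLe34052_of (h₁ : NumLB3749) (h₂ : DenUB3750) (h₃ : Tuple3750) : HTwoLe34052 :=
  closes assembly_holds certGlue_holds h₁ h₂ h₃

end Summit.Parity.GeneralizedHardyLittlewood.Theses.MaynardProductExact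

end
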